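import Summits.QuantumFields.YangMills.Theses.HistoryWedge

/-!
# Crux `HistoryTailL` (stmt-QuantumFields-19936) — LINE «history-wedge» (ideator seat ym-r3-idea-2 g4, lens «nearmiss»)

The line IS route `HistoryWedge` (route-QuantumFields-HistoryWedge, DRAFT, tribunal pending; critic idea-crit-5 to vet): its crux `WedgeTailL`
(rank 2: the per-plaquette geometric rate ONLY on the history wedge `K ≤ m·(K − j + 1)` — the heights the consumer `UnitScaleTilt.closes`
actually inspects — with m-dependent constants) split into the two REGIME STUBS of its birth skeleton (shallow wedge `2j ≤ K + 2`, steep wedge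
`K + 2 < 2j ∧ K ≤ m(K−j+1)`, both upward-closed in the profile so the join `WedgeTailL_of` is pure logic), plus the glue item `HistoryTailOfWedge`
(support r9, provable now: the window-restricted re-run of `T3HistoryTailReduction.historyTailAt_of_heightTail` + union bound + the landed bare
tail) BY NAME, give `UnitScaleTilt.HistoryTailL` BY NAME.  Sorries ONLY inside `stub_*`.  No summit, no rung (`YM3TorusSU2`), no mass gap is
proved; `HistoryTailL` stays open behind the stubs.
-/

namespace Summit.QuantumFields.YangMills.Cruxes.HistoryTailL.HistoryWedge

open scoped BigOperators Topology Classical MeasureTheory ProbabilityTheory Matrix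
open Filter Set Function TopologicalSpace MeasureTheory
open Summit.QuantumFields.YangMills.Theses.HistoryWedge (WedgeTailL HistoryTailOfWedge)

/-! ## §1 The registered stubs (the ONLY sorries) -/

/-- stub (M/L, = item `HistoryTailOfWedge`, support r9 of route `HistoryWedge`: window-restricted history reduction + union bound + bare tail). -/
theorem stub_historyTailOfWedge : HistoryTailOfWedge := by
  sorry

/-- STUB 1 (shallow wedge `2j ≤ K + 2`: at most K − j + 1 averaging steps over the remaining height; the whole wedge when m ≤ 2):
per-plaquette geometric rate `≤ D·ρ^(K−j)`, `ρ·L³ < 1`, upward-closed in the profile. -/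
theorem stub_shallowWedge : open Literature.MathematicalPhysics.QuantumFieldTheory.Balaban1983to89 Literature.MathematicalPhysics.QuantumFieldTheory.Balaban1983to89.T3ContinuumYM3Torus in ∀ (L : ℕ), ∃ (b₂ p₂ : ℝ), ∀ (b₀ p₀ : ℝ), b₂ ≤ b₀ → p₂ ≤ p₀ → 0 < b₀ → 2 < p₀ → ∀ (m : ℕ), 0 < m → ∃ γ₁ : ℝ, 0 < γ₁ ∧ γ₁ ≤ 1 ∧ ∀ (F : T3Family) (γ : ℝ), F.L = L → 0 < γ → γ ≤ γ₁ → ∃ (D ρ : ℝ), 0 ≤ D ∧ 0 ≤ ρ ∧ ρ * (L : ℝ) ^ 3 < 1 ∧ ∀ (K j : ℕ), 1 ≤ j → j ≤ K → 2 * j ≤ K + 2 → ∀ (p : Plaq (F.P K) j), (T3UnitScaleTilt.gibbsK F T3UnitLawDensityEML.ℰp γ K).real {U | T3UnitScaleTilt.θBal F.L γ b₀ p₀ (K - j) ≤ GaugeGroup.dist1 (GaugeField.plaqHol (Averaging.iter (fun i => BlockAveraging.blockAvg (P := F.P K) (j := i) T3UnitLawDensityEML.ℰp) j U) p)} ≤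 D * ρ ^ (K - j) := by
  sorry

/-- STUB 2 (steep wedge `K + 2 < 2j`, `K ≤ m(K−j+1)`; empty for m ≤ 2): the same rate with m-dependent (γ₁, D, ρ) — the load-bearing stub
(wedge transfer m → m+1: one more band of heights, each met by finitely many cut-offs). -/
theorem stub_steepWedge : open Literature.MathematicalPhysics.QuantumFieldTheory.Balaban1983to89 Literature.MathematicalPhysics.QuantumFieldTheory.Balaban1983to89.T3ContinuumYM3Torus in ∀ (L : ℕ), ∃ (b₂ p₂ : ℝ), ∀ (b₀ p₀ : ℝ), b₂ ≤ b₀ → p₂ ≤ p₀ → 0 < b₀ → 2 < p₀ → ∀ (m : ℕ), 0 < m → ∃ γ₁ : ℝ, 0 < γ₁ ∧ γ₁ ≤ 1 ∧ ∀ (F : T3Family) (γ : ℝ), F.L = L → 0 < γ → γ ≤ γ₁ → ∃ (D ρ : ℝ), 0 ≤ D ∧ 0 ≤ ρ ∧ ρ * (L : ℝ) ^ 3 < 1 ∧ ∀ (K j : ℕ), 1 ≤ j → j ≤ K → K + 2 < 2 * j → K ≤ m * (K - j + 1) → ∀ (p : Plaq (F.P K) j), (T3UnitScaleTilt.gibbsK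 F T3UnitLawDensityEML.ℰp γ K).real {U | T3UnitScaleTilt.θBal F.L γ b₀ p₀ (K - j) ≤ GaugeGroup.dist1 (GaugeField.plaqHol (Averaging.iter (fun i => BlockAveraging.blockAvg (P := F.P K) (j := i) T3UnitLawDensityEML.ℰp) j U) p)} ≤ D * ρ ^ (K - j) := by
  sorry

/-! ## §2 Composition (kernel-checked, no sorry) -/

/-- the two regime stubs give the route crux `WedgeTailL` BY NAME (common profile = max, γ₁ = min, (D, ρ) = max). -/
theorem WedgeTailL_of (h₁ : open Literature.MathematicalPhysics.QuantumFieldTheory.Balaban1983to89 Literature.MathematicalPhysics.QuantumFieldTheory.Balaban1983to89.T3ContinuumYM3Torus in ∀ (L : ℕ), ∃ (b₂ p₂ : ℝ), ∀ (b₀ p₀ : ℝ), b₂ ≤ b₀ → p₂ ≤ p₀ → 0 < b₀ → 2 < p₀ → ∀ (m : ℕ), 0 < m → ∃ γ₁ : ℝ, 0 < γ₁ ∧ γ₁ ≤ 1 ∧ ∀ (F : T3Family) (γ : ℝ), F.L = L → 0 < γ → γ ≤ γ₁ → ∃ (D ρ : ℝ), 0 ≤ D ∧ 0 ≤ ρ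 ∧ ρ * (L : ℝ) ^ 3 < 1 ∧ ∀ (K j : ℕ), 1 ≤ j → j ≤ K → 2 * j ≤ K + 2 → ∀ (p : Plaq (F.P K) j), (T3UnitScaleTilt.gibbsK F T3UnitLawDensityEML.ℰp γ K).real {U | T3UnitScaleTilt.θBal F.L γ b₀ p₀ (K - j) ≤ GaugeGroup.dist1 (GaugeField.plaqHol (Averaging.iter (fun i => BlockAveraging.blockAvg (P := F.P K) (j := i) T3UnitLawDensityEML.ℰp) j U) p)} ≤ D * ρ ^ (K - j)) (h₂ : open Literature.MathematicalPhysics.QuantumFieldTheory.Balaban1983to89 Literature.MathematicalPhysics.QuantumFieldTheory.Balaban1983to89.T3ContinuumYM3Torus in ∀ (L : ℕ), ∃ (b₂ p₂ : ℝ), ∀ (b₀ p₀ : ℝ), b₂ ≤ b₀ → p₂ ≤ p₀ → 0 < b₀ → 2 < p₀ → ∀ (m : ℕ), 0 < m → ∃ γ₁ : ℝ, 0 < γ₁ ∧ γ₁ ≤ 1 ∧ ∀ (F : T3Family) (γ : ℝ), F.L = L → 0 < γ → γ ≤ γ₁ → ∃ (D ρ : ℝ), 0 ≤ D ∧ 0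 ≤ ρ ∧ ρ * (L : ℝ) ^ 3 < 1 ∧ ∀ (K j : ℕ), 1 ≤ j → j ≤ K → K + 2 < 2 * j → K ≤ m * (K - j + 1) → ∀ (p : Plaq (F.P K) j), (T3UnitScaleTilt.gibbsK F T3UnitLawDensityEML.ℰp γ K).real {U | T3UnitScaleTilt.θBal F.L γ b₀ p₀ (K - j) ≤ GaugeGroup.dist1 (GaugeField.plaqHol (Averaging.iter (fun i => BlockAveraging.blockAvg (P := F.P K) (j := i) T3UnitLawDensityEML.ℰp) j U) p)} ≤ D * ρ ^ (K - j)) : WedgeTailL := by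
  intro L b₁ p₁
  obtain ⟨b₂, p₂, H₁⟩ := h₁ L
  obtain ⟨b₃, p₃, H₂⟩ := h₂ L
  have hb1 : (1 : ℝ) ≤ max (max b₁ b₂) (max b₃ 1) := le_max_of_le_right (le_max_right _ _)
  have hp3 : (3 : ℝ) ≤ max (max p₁ p₂) (max p₃ 3) := le_max_of_le_right (le_max_right _ _)
  have hb0 : 0 < max (max b₁ b₂) (max b₃ 1) := lt_of_lt_of_le one_pos hb1
  have hp0 : 2 < max (max p₁ p₂) (max p₃ 3) := lt_of_lt_of_le (by norm_num) hp3
  refine ⟨max (max b₁ b₂) (max b₃ 1), max (max p₁ p₂) (max p₃ 3), le_max_of_le_left (le_max_left _ _),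
    le_max_of_le_left (le_max_left _ _), hb0, hp0, fun m hm => ?_⟩
  obtain ⟨γ₁, hγ₁, hγ₁1, G₁⟩ := H₁ _ _ (le_max_of_le_left (le_max_right _ _)) (le_max_of_le_left (le_max_right _ _)) hb0 hp0 m hm
  obtain ⟨γ₂, hγ₂, hγ₂1, G₂⟩ := H₂ _ _ (le_max_of_le_right (le_max_left _ _)) (le_max_of_le_right (le_max_left _ _)) hb0 hp0 m hm
  refine ⟨min γ₁ γ₂, lt_min hγ₁ hγ₂, (min_le_left _ _).trans hγ₁1, fun F γ hF hγ hγle => ?_⟩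
  obtain ⟨D₁, ρ₁, hD₁, hρ₁, hρ₁L, B₁⟩ := G₁ F γ hF hγ (hγle.trans (min_le_left _ _))
  obtain ⟨D₂, ρ₂, hD₂, hρ₂, hρ₂L, B₂⟩ := G₂ F γ hF hγ (hγle.trans (min_le_right _ _))
  have hL3 : (0 : ℝ) ≤ (L : ℝ) ^ 3 := by positivity
  refine ⟨max D₁ D₂, max ρ₁ ρ₂, le_max_of_le_left hD₁, le_max_of_le_left hρ₁, ?_, fun K j hj hjK hw p => ?_⟩
  · rw [max_mul_of_nonneg _ _ hL3]; exact max_lt hρ₁L hρ₂L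
  · by_cases hreg : 2 * j ≤ K + 2
    · calc _ ≤ D₁ * ρ₁ ^ (K - j) := B₁ K j hj hjK hreg p
        _ ≤ max D₁ D₂ * max ρ₁ ρ₂ ^ (K - j) :=
          mul_le_mul (le_max_left _ _) (pow_le_pow_left₀ hρ₁ (le_max_left _ _) _) (pow_nonneg hρ₁ _) (hD₁.trans (le_max_left _ _))
    · calc _ ≤ D₂ * ρ₂ ^ (K - j) := B₂ K j hj hjK (Nat.lt_of_not_le hreg) hw p
        _ ≤ max D₁ D₂ * max ρ₁ ρ₂ ^ (K - j) :=
          mul_le_mul (le_max_right _ _) (pow_le_pow_left₀ hρ₂ (le_max_right _ _) _) (pow_nonneg hρ₂ _) (hD₁.trans (le_max_left _ _))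

/-- `UnitScaleTilt.HistoryTailL` BY NAME from the three stubs (the glue item applied to the joined regime stubs). -/
theorem HistoryTailL_of : Summit.QuantumFields.YangMills.Theses.UnitScaleTilt.HistoryTailL :=
  stub_historyTailOfWedge (WedgeTailL_of stub_shallowWedge stub_steepWedge)

end Summit.QuantumFields.YangMills.Cruxes.HistoryTailL.HistoryWedge
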